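import Summits.QuantumFields.YangMills.Theorems.ColdStartUniversalityLatticeLangevinWilsonAutocorrelationLogConvex
import HarnessLib

/-!
# Route `ColdStartUniversality` (fixed-cut-off `L²(μ_{β'})` package): the semigroup Dirichlet forms `𝓔_h` as SEMINORMS,
# the smoothing bound `𝓔_h(κ_s G) ≤ Var(G)/(2s)`, and forward slopes of convex functions near `0` — tools for
# «generator-form Poincaré ⇒ decay» WITHOUT a smoothing hypothesis

Helper file (seat `ym-line-csu-p1`, g18; `--supports stmt-QuantumFields-27363`).  For the SU(2) lattice Langevin dynamics of
Shen–Zhu–Zhu at any `L, β'` (reversible w.r.t. the Wilson measure `μ = μ_{β'}`), a continuous `G` with `G₀ = G − μG` and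
`Φ(u) := ∫ G₀ κ_u G₀ dμ` (convex, continuous, `≥ 0`: `convexOn_integral_mul_transition`), the semigroup Dirichlet form at scale `h`
is `𝓔_h(G) = h⁻¹(∫ G² dμ − ∫ G κ_h G dμ) = h⁻¹(Φ(0) − Φ(h))`.

* §1 `exists_forward_slope_ge_of_convexOn` — ABSTRACT: for `φ` convex on `[0,∞)` and continuous at `0⁺`, the forward slopes
  `(φ(s) − φ(s+h))/h` with `s + h ≤ h₁` are eventually (small `s`) `≥ (φ(0) − φ(h₁))/h₁ − ε` — the sup-free form of
  «the right derivative of a convex function is right-continuous».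
* §2 `dirichletScale_add_le` — `𝓔_h(u + v) ≤ (1+t) 𝓔_h(u) + (1+t⁻¹) 𝓔_h(v)` (`t > 0`): `√𝓔_h` is a seminorm (symmetry =
  reversibility `integral_mul_transition_symm_su2`, positivity = `L²`-contraction).
* §3 `dirichletScale_transition_le_var` — SMOOTHING BOUND `𝓔_h(κ_s G) ≤ (2s)⁻¹ Var_μ(G)` for every `h` (secant of the convex `Φ`
  over `[2s, 2s+h]` vs. over `[0, 2s]`, and `Φ ≥ 0`).
(Sequel `…WilsonDirichletScaleSmallScales`: `𝓔_h(G − κ_sG) → 0` at small scales.)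

THEOREMS ONLY, no definition, no sorry.  HONEST FRAMING: RECORD-rung R3 plumbing at FIXED cut-off (inputs of the unconditional
«generator-form Poincaré ⇒ `L²` decay» of the sequel); nothing K-uniform is proved; no crux, rung or summit statement is proved;
the Yang–Mills mass gap is NOT proved.
-/

set_option autoImplicit false

noncomputable section

namespace Summit.QuantumFields.YangMills.Theorems.ColdStartUniversality

open MeasureTheory ProbabilityTheory Filter Set Topology
open scoped BigOperators NNReal ENNReal
open Literature.Probability.Process Literature.MathematicalPhysics.QuantumFieldTheory
open Literature.MathematicalPhysics.QuantumLattice (fundamentalRep fundamentalLatticeRep continuous_fundamentalRep)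

/-! ## §1. Forward slopes of a convex function near `0` -/

/-- **Right-continuity of the right derivative of a convex function at `0`, sup-free form.**  Let `φ` be convex on `[0, ∞)` and
continuous at `0` from the right, `h₁ > 0`, `ε > 0`.  Then there is `δ ∈ (0, h₁)` such that for all `0 < s ≤ δ` and `h > 0` with
`s + h ≤ h₁`: `(φ(0) − φ(h₁))/h₁ − ε ≤ (φ(s) − φ(s+h))/h` (secant monotonicity `slope[s, s+h] ≤ slope[s, h₁]` and continuity of
`s ↦ (φ(s) − φ(h₁))/(h₁ − s)` at `0`). [cite: HardyLittlewoodPolya1952, §3.18 (111)] -/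
theorem exists_forward_slope_ge_of_convexOn {φ : ℝ → ℝ} (hφ : ConvexOn ℝ (Ici 0) φ)
    (hφc : ContinuousWithinAt φ (Ici 0) 0) {h₁ ε : ℝ} (hh₁ : 0 < h₁) (hε : 0 < ε) :
    ∃ δ : ℝ, 0 < δ ∧ δ < h₁ ∧ ∀ s : ℝ, 0 < s → s ≤ δ → ∀ h : ℝ, 0 < h → s + h ≤ h₁ →
      (φ 0 - φ h₁) / h₁ - ε ≤ (φ s - φ (s + h)) / h := by
  -- continuity of `s ↦ (φ s − φ h₁)/(h₁ − s)` at `0` within `[0, ∞)`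
  have hg : ContinuousWithinAt (fun s : ℝ => (φ s - φ h₁) / (h₁ - s)) (Ici 0) 0 := by
    refine (hφc.sub continuousWithinAt_const).div (continuousWithinAt_const.sub continuousWithinAt_id) ?_
    simp only [sub_zero]; exact hh₁.ne'
  have hev : ∀ᶠ s : ℝ in 𝓝[Ici 0] 0, dist ((φ s - φ h₁) / (h₁ - s)) ((φ 0 - φ h₁) / (h₁ - 0)) < ε :=
    Metric.tendsto_nhds.1 hg ε hε
  obtain ⟨δ₀, hδ₀, hball⟩ := Metric.eventually_nhds_iff.1 (eventually_nhdsWithin_iff.1 hev)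
  set δ : ℝ := min (δ₀ / 2) (h₁ / 2) with hδ
  have hδpos : 0 < δ := lt_min (by positivity) (by positivity)
  have hδh₁ : δ < h₁ := (min_le_right _ _).trans_lt (by linarith)
  refine ⟨δ, hδpos, hδh₁, fun s hs hsδ h hh hsh => ?_⟩
  -- (a) the limit value is within `ε`
  have hsδ₀ : dist s 0 < δ₀ := by
    rw [Real.dist_eq, sub_zero, abs_of_pos hs]
    exact lt_of_le_of_lt (hsδ.trans (min_le_left _ _)) (by linarith)
  have hclose := hball hsδ₀ (show s ∈ Ici (0 : ℝ) from hs.le)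
  rw [sub_zero, Real.dist_eq] at hclose
  have h1 : (φ 0 - φ h₁) / h₁ - ε ≤ (φ s - φ h₁) / (h₁ - s) := by
    have := (abs_lt.1 hclose).1; linarith
  -- (b) secant monotonicity from `s`
  have hs1 : s < h₁ := by linarith
  have h2 : (φ s - φ h₁) / (h₁ - s) ≤ (φ s - φ (s + h)) / h := by
    rcases eq_or_lt_of_le hsh with heq | hlt
    · -- `s + h = h₁`
      have eh : h = h₁ - s := by linarith
      rw [eh, show s + (h₁ - s) = h₁ by ring]
    · have hsec := hφ.secant_mono (a := s) (x := s + h) (y := h₁)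
        (by simp only [mem_Ici]; exact hs.le) (by simp only [mem_Ici]; linarith) (by simp only [mem_Ici]; linarith)
        (by linarith) (by linarith) hlt.le
      rw [show s + h - s = h by ring] at hsec
      -- `(φ(s+h) − φ s)/h ≤ (φ h₁ − φ s)/(h₁ − s)`
      have e1 : (φ s - φ (s + h)) / h = -((φ (s + h) - φ s) / h) := by ring
      have e2 : (φ s - φ h₁) / (h₁ - s) = -((φ h₁ - φ s) / (h₁ - s)) := by ring
      rw [e1, e2]
      exact neg_le_neg hsec
  exact h1.trans h2

/-! ## §2. `√𝓔_h` is a seminorm -/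

variable {L : ℕ} [NeZero L]

/-- **The semigroup Dirichlet form at scale `h` is a seminorm squared**: for continuous `u, v` and `t > 0`,
`Q_h(u + v) ≤ (1 + t) Q_h(u) + (1 + t⁻¹) Q_h(v)` where `Q_h(w) = ∫ w² dμ_{β'} − ∫ w κ_h w dμ_{β'} = h 𝓔_h(w)`.  Proof: the bilinear
form `B(a,b) = ∫ ab dμ − ∫ a κ_h b dμ` is symmetric (reversibility `integral_mul_transition_symm_su2`) and `Q_h ≥ 0`
(`L²`-contraction), so `Q_h(tu − v) ≥ 0` gives `2B(u,v) ≤ t Q_h(u) + t⁻¹ Q_h(v)`. [folklore] -/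
theorem dirichletScale_add_le (L : ℕ) [NeZero L] (β' : ℝ)
    (κ : ℝ≥0 → Kernel (GaugeConfig 3 L (Matrix.specialUnitaryGroup (Fin 2) ℂ))
      (GaugeConfig 3 L (Matrix.specialUnitaryGroup (Fin 2) ℂ))) [∀ t, IsMarkovKernel (κ t)]
    (hreal : ∀ (t : ℝ≥0) (x : GaugeConfig 3 L (Matrix.specialUnitaryGroup (Fin 2) ℂ))
        (Ω : Type) [MeasurableSpace Ω] (P : Measure Ω) [IsProbabilityMeasure P]
        (W : ℝ≥0 → Ω → (Edge 3 L × NoiseIdx 2 → ℝ)) (hW : IsFlatBrownian W P)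
        (U : ℝ≥0 → Ω → GaugeConfig 3 L (Matrix.specialUnitaryGroup (Fin 2) ℂ)),
        (∀ ω, U 0 ω = x) →
        (latticeLangevinDynamics (fundamentalLatticeRep 2) β').IsSolution (fundamentalRep (Fin 2))
          hW.natFiltration P W U →
        κ t x = P.map (U t))
    (h : ℝ≥0) {u v : GaugeConfig 3 L (Matrix.specialUnitaryGroup (Fin 2) ℂ) → ℝ} (hu : Continuous u) (hv : Continuous v)
    {t : ℝ} (ht : 0 < t) :
    (∫ x, (u x + v x) * (u x + v x) ∂(wilsonMeasure (d := 3) (L := L) (fundamentalRep (Fin 2)) β')) -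
        ∫ x, (u x + v x) * (∫ y, (u y + v y) ∂(κ h x)) ∂(wilsonMeasure (d := 3) (L := L) (fundamentalRep (Fin 2)) β') ≤
      (1 + t) * ((∫ x, u x * u x ∂(wilsonMeasure (d := 3) (L := L) (fundamentalRep (Fin 2)) β')) -
          ∫ x, u x * (∫ y, u y ∂(κ h x)) ∂(wilsonMeasure (d := 3) (L := L) (fundamentalRep (Fin 2)) β')) +
        (1 + t⁻¹) * ((∫ x, v x * v x ∂(wilsonMeasure (d := 3) (L := L) (fundamentalRep (Fin 2)) β')) -
          ∫ x, v x * (∫ y, v y ∂(κ h x)) ∂(wilsonMeasure (d := 3) (L := L) (fundamentalRep (Fin 2)) β')) := by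
  classical
  haveI := secondCountableTopology_su2
  haveI := borelSpace_config L
  set μ : Measure (GaugeConfig 3 L (Matrix.specialUnitaryGroup (Fin 2) ℂ)) :=
    wilsonMeasure (d := 3) (L := L) (fundamentalRep (Fin 2)) β' with hμ
  haveI : IsProbabilityMeasure μ :=
    isProbabilityMeasure_wilsonMeasure (d := 3) (L := L) (fundamentalRep (Fin 2)) (continuous_fundamentalRep (Fin 2)) β'
  -- integrability against the probability measures `κ h x`
  have hint : ∀ {w : GaugeConfig 3 L (Matrix.specialUnitaryGroup (Fin 2) ℂ) → ℝ}, Continuous w →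
      ∀ (ν : Measure (GaugeConfig 3 L (Matrix.specialUnitaryGroup (Fin 2) ℂ))) [IsProbabilityMeasure ν], Integrable w ν := by
    intro w hw ν _
    obtain ⟨M, -, hM⟩ := exists_abs_le_of_continuous hw
    exact Integrable.of_bound hw.aestronglyMeasurable M (Eventually.of_forall fun z => by rw [Real.norm_eq_abs]; exact hM z)
  set Ku : GaugeConfig 3 L (Matrix.specialUnitaryGroup (Fin 2) ℂ) → ℝ := fun x => ∫ y, u y ∂(κ h x) with hKu
  set Kv : GaugeConfig 3 L (Matrix.specialUnitaryGroup (Fin 2) ℂ) → ℝ := fun x => ∫ y, v y ∂(κ h x) with hKv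
  have hKuc : Continuous Ku := continuous_integral_transitionKernel L β' κ hreal h hu
  have hKvc : Continuous Kv := continuous_integral_transitionKernel L β' κ hreal h hv
  have hKadd : ∀ x, ∫ y, (u y + v y) ∂(κ h x) = Ku x + Kv x := fun x => integral_add (hint hu _) (hint hv _)
  have htuv : Continuous fun y => t * u y - v y := (continuous_const.mul hu).sub hv
  have hKlin : ∀ x, ∫ y, (t * u y - v y) ∂(κ h x) = t * Ku x - Kv x := by
    intro x
    rw [integral_sub ((hint hu _).const_mul t) (hint hv _), integral_const_mul]
  -- symmetry of the bilinear form (reversibility)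
  have hsymm : ∫ x, v x * Ku x ∂μ = ∫ x, u x * Kv x ∂μ := by
    simp only [hKu, hKv]; exact (integral_mul_transition_symm_su2 L β' κ hreal h hu hv).symm
  -- positivity on `t u − v` (the `L²`-contraction at `t = 0`)
  have hpos : ∫ x, (t * u x - v x) * (∫ y, (t * u y - v y) ∂(κ h x)) ∂μ ≤ ∫ x, (t * u x - v x) * (t * u x - v x) ∂μ := by
    have ha := integral_mul_transition_self_antitone L β' κ hreal 0 h htuv
    rw [zero_add, transitionKernel_zero_eq_id L β' κ hreal] at ha
    simpa only [Kernel.id_apply, integral_dirac] using ha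
  -- the seven basic integrands are integrable
  have iuu : Integrable (fun x => u x * u x) μ := integrable_of_continuous_of_compactSpace (hu.mul hu) μ
  have ivv : Integrable (fun x => v x * v x) μ := integrable_of_continuous_of_compactSpace (hv.mul hv) μ
  have iuv : Integrable (fun x => u x * v x) μ := integrable_of_continuous_of_compactSpace (hu.mul hv) μ
  have iuKu : Integrable (fun x => u x * Ku x) μ := integrable_of_continuous_of_compactSpace (hu.mul hKuc) μ
  have iuKv : Integrable (fun x => u x * Kv x) μ := integrable_of_continuous_of_compactSpace (hu.mul hKvc) μ
  have ivKu : Integrable (fun x => v x * Ku x) μ := integrable_of_continuous_of_compactSpace (hv.mul hKuc) μ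
  have ivKv : Integrable (fun x => v x * Kv x) μ := integrable_of_continuous_of_compactSpace (hv.mul hKvc) μ
  -- expansions
  have e1 : ∫ x, (t * u x - v x) * (t * u x - v x) ∂μ =
      t ^ 2 * (∫ x, u x * u x ∂μ) - 2 * t * (∫ x, u x * v x ∂μ) + ∫ x, v x * v x ∂μ := by
    have e : ∀ x, (t * u x - v x) * (t * u x - v x) = (t ^ 2 * (u x * u x) - 2 * t * (u x * v x)) + v x * v x := by
      intro x; ring
    simp_rw [e]
    have i1 : Integrable (fun x => t ^ 2 * (u x * u x)) μ := iuu.const_mul _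
    have i2 : Integrable (fun x => 2 * t * (u x * v x)) μ := iuv.const_mul _
    have i12 : Integrable (fun x => t ^ 2 * (u x * u x) - 2 * t * (u x * v x)) μ := i1.sub i2
    rw [integral_add i12 ivv, integral_sub i1 i2, integral_const_mul, integral_const_mul]
  have e2 : ∫ x, (t * u x - v x) * (∫ y, (t * u y - v y) ∂(κ h x)) ∂μ =
      t ^ 2 * (∫ x, u x * Ku x ∂μ) - t * (∫ x, u x * Kv x ∂μ) - t * (∫ x, v x * Ku x ∂μ) + ∫ x, v x * Kv x ∂μ := by
    simp_rw [hKlin]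
    have e : ∀ x, (t * u x - v x) * (t * Ku x - Kv x) =
        ((t ^ 2 * (u x * Ku x) - t * (u x * Kv x)) - t * (v x * Ku x)) + v x * Kv x := by
      intro x; ring
    simp_rw [e]
    have i1 : Integrable (fun x => t ^ 2 * (u x * Ku x)) μ := iuKu.const_mul _
    have i2 : Integrable (fun x => t * (u x * Kv x)) μ := iuKv.const_mul _
    have i3 : Integrable (fun x => t * (v x * Ku x)) μ := ivKu.const_mul _
    have i12 : Integrable (fun x => t ^ 2 * (u x * Ku x) - t * (u x * Kv x)) μ := i1.sub i2
    have i123 : Integrable (fun x => (t ^ 2 * (u x * Ku x) - t * (u x * Kv x)) - t * (v x * Ku x)) μ := i12.sub i3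
    rw [integral_add i123 ivKv, integral_sub i12 i3, integral_sub i1 i2, integral_const_mul, integral_const_mul,
      integral_const_mul]
  have e3 : ∫ x, (u x + v x) * (u x + v x) ∂μ =
      (∫ x, u x * u x ∂μ) + 2 * (∫ x, u x * v x ∂μ) + ∫ x, v x * v x ∂μ := by
    have e : ∀ x, (u x + v x) * (u x + v x) = (u x * u x + 2 * (u x * v x)) + v x * v x := by intro x; ring
    simp_rw [e]
    have i2 : Integrable (fun x => 2 * (u x * v x)) μ := iuv.const_mul _
    have i12 : Integrable (fun x => u x * u x + 2 * (u x * v x)) μ := iuu.add i2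
    rw [integral_add i12 ivv, integral_add iuu i2, integral_const_mul]
  have e4 : ∫ x, (u x + v x) * (∫ y, (u y + v y) ∂(κ h x)) ∂μ =
      (∫ x, u x * Ku x ∂μ) + (∫ x, u x * Kv x ∂μ) + (∫ x, v x * Ku x ∂μ) + ∫ x, v x * Kv x ∂μ := by
    simp_rw [hKadd]
    have e : ∀ x, (u x + v x) * (Ku x + Kv x) = ((u x * Ku x + u x * Kv x) + v x * Ku x) + v x * Kv x := by
      intro x; ring
    simp_rw [e]
    have i12 : Integrable (fun x => u x * Ku x + u x * Kv x) μ := iuKu.add iuKv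
    have i123 : Integrable (fun x => (u x * Ku x + u x * Kv x) + v x * Ku x) μ := i12.add ivKu
    rw [integral_add i123 ivKv, integral_add i12 ivKu, integral_add iuKu iuKv]
  rw [e1, e2, hsymm] at hpos
  show (∫ x, (u x + v x) * (u x + v x) ∂μ) - ∫ x, (u x + v x) * (∫ y, (u y + v y) ∂(κ h x)) ∂μ ≤
    (1 + t) * ((∫ x, u x * u x ∂μ) - ∫ x, u x * Ku x ∂μ) + (1 + t⁻¹) * ((∫ x, v x * v x ∂μ) - ∫ x, v x * Kv x ∂μ)
  rw [e3, e4, hsymm]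
  -- `2 B ≤ t Q(u) + t⁻¹ Q(v)` from `Q(tu − v) ≥ 0`
  set Qu : ℝ := (∫ x, u x * u x ∂μ) - ∫ x, u x * Ku x ∂μ with hQu
  set Qv : ℝ := (∫ x, v x * v x ∂μ) - ∫ x, v x * Kv x ∂μ with hQv
  set B : ℝ := (∫ x, u x * v x ∂μ) - ∫ x, u x * Kv x ∂μ with hB
  have key : 2 * t * B ≤ t ^ 2 * Qu + Qv := by
    simp only [hQu, hQv, hB]; nlinarith [hpos]
  have key' : 2 * B ≤ t * Qu + t⁻¹ * Qv := by
    rw [← sub_nonneg]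
    have e : t * Qu + t⁻¹ * Qv - 2 * B = t⁻¹ * (t ^ 2 * Qu + Qv - 2 * t * B) := by
      field_simp
    rw [e]
    exact mul_nonneg (inv_nonneg.2 ht.le) (by linarith)
  have etot : (∫ x, u x * u x ∂μ) + 2 * (∫ x, u x * v x ∂μ) + (∫ x, v x * v x ∂μ) -
      ((∫ x, u x * Ku x ∂μ) + (∫ x, u x * Kv x ∂μ) + (∫ x, u x * Kv x ∂μ) + ∫ x, v x * Kv x ∂μ) = Qu + Qv + 2 * B := by
    simp only [hQu, hQv, hB]; ring
  rw [etot]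
  nlinarith [key', ht]

/-! ## §3. Smoothing bound: the energy of `κ_s G` is controlled by `Var(G)/s` -/

/-- **`𝓔_h(κ_s G) ≤ (2s)⁻¹ Var_μ(G)`** for `s > 0` and every `h`, in the form `Q_h(κ_sG) ≤ (h/(2s)) Var_μ(G)`: with `G₀ = G − μG` and
the convex, non-negative `Φ(u) = ∫ G₀ κ_u G₀ dμ`, `Q_h(κ_sG) = Φ(2s) − Φ(2s+h) ≤ (h/2s)(Φ(0) − Φ(2s)) ≤ (h/2s) Φ(0)` (secant of `Φ`
over `[2s, 2s+h]` dominates the secant over `[0, 2s]`). [cite: BakryGentilLedoux2014, (4.2.3)] -/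
theorem dirichletScale_transition_le_var (L : ℕ) [NeZero L] (β' : ℝ)
    (κ : ℝ≥0 → Kernel (GaugeConfig 3 L (Matrix.specialUnitaryGroup (Fin 2) ℂ))
      (GaugeConfig 3 L (Matrix.specialUnitaryGroup (Fin 2) ℂ))) [∀ t, IsMarkovKernel (κ t)]
    (hreal : ∀ (t : ℝ≥0) (x : GaugeConfig 3 L (Matrix.specialUnitaryGroup (Fin 2) ℂ))
        (Ω : Type) [MeasurableSpace Ω] (P : Measure Ω) [IsProbabilityMeasure P]
        (W : ℝ≥0 → Ω → (Edge 3 L × NoiseIdx 2 → ℝ)) (hW : IsFlatBrownian W P)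
        (U : ℝ≥0 → Ω → GaugeConfig 3 L (Matrix.specialUnitaryGroup (Fin 2) ℂ)),
        (∀ ω, U 0 ω = x) →
        (latticeLangevinDynamics (fundamentalLatticeRep 2) β').IsSolution (fundamentalRep (Fin 2))
          hW.natFiltration P W U →
        κ t x = P.map (U t))
    {s : ℝ≥0} (hs : 0 < s) (h : ℝ≥0) {G : GaugeConfig 3 L (Matrix.specialUnitaryGroup (Fin 2) ℂ) → ℝ} (hG : Continuous G) :
    (∫ x, (∫ y, G y ∂(κ s x)) * (∫ y, G y ∂(κ s x)) ∂(wilsonMeasure (d := 3) (L := L) (fundamentalRep (Fin 2)) β')) -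
        ∫ x, (∫ y, G y ∂(κ s x)) * (∫ y, (∫ z, G z ∂(κ s y)) ∂(κ h x))
          ∂(wilsonMeasure (d := 3) (L := L) (fundamentalRep (Fin 2)) β') ≤
      (h : ℝ) / (2 * s) * ∫ x, (G x - ∫ z, G z ∂(wilsonMeasure (d := 3) (L := L) (fundamentalRep (Fin 2)) β')) ^ 2
        ∂(wilsonMeasure (d := 3) (L := L) (fundamentalRep (Fin 2)) β') := by
  classical
  haveI := secondCountableTopology_su2
  haveI := borelSpace_config L
  set μ : Measure (GaugeConfig 3 L (Matrix.specialUnitaryGroup (Fin 2) ℂ)) :=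
    wilsonMeasure (d := 3) (L := L) (fundamentalRep (Fin 2)) β' with hμ
  haveI : IsProbabilityMeasure μ :=
    isProbabilityMeasure_wilsonMeasure (d := 3) (L := L) (fundamentalRep (Fin 2)) (continuous_fundamentalRep (Fin 2)) β'
  set m : ℝ := ∫ z, G z ∂μ with hm
  set G₀ : GaugeConfig 3 L (Matrix.specialUnitaryGroup (Fin 2) ℂ) → ℝ := fun x => G x - m with hG₀
  have hG₀c : Continuous G₀ := hG.sub continuous_const
  obtain ⟨M, -, hM⟩ := exists_abs_le_of_continuous hG
  have hGi : ∀ (ν : Measure (GaugeConfig 3 L (Matrix.specialUnitaryGroup (Fin 2) ℂ))) [IsProbabilityMeasure ν],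
      Integrable G ν := fun ν _ =>
    Integrable.of_bound hG.aestronglyMeasurable M (Eventually.of_forall fun z => by rw [Real.norm_eq_abs]; exact hM z)
  have hκG₀ : ∀ (u : ℝ≥0) x, ∫ y, G₀ y ∂(κ u x) = (∫ y, G y ∂(κ u x)) - m := by
    intro u x
    simp only [hG₀]
    rw [integral_sub (hGi _) (integrable_const m), integral_const, probReal_univ, one_smul]
  have hκGm : ∫ x, (∫ y, G y ∂(κ s x)) ∂μ = m :=
    integral_transitionKernel_integral_eq_wilson (L := L) β' κ hreal s hG.measurable ⟨M, hM⟩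
  have hκGc : Continuous fun x => ∫ y, G y ∂(κ s x) := continuous_integral_transitionKernel L β' κ hreal s hG
  -- centre: `Q_h(κ_sG) = ∫ (κ_sG₀)² − ∫ κ_sG₀ κ_h(κ_sG₀)`
  have hcen := dirichletScale_eq_centred L β' κ hreal h hκGc
  rw [hκGm] at hcen
  have e1 : ∀ x, (∫ y, G y ∂(κ s x)) - m = ∫ y, G₀ y ∂(κ s x) := fun x => (hκG₀ s x).symm
  have hcen' : (∫ x, (∫ y, G y ∂(κ s x)) * (∫ y, G y ∂(κ s x)) ∂μ) -
      ∫ x, (∫ y, G y ∂(κ s x)) * (∫ y, (∫ z, G z ∂(κ s y)) ∂(κ h x)) ∂μ =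
      (∫ x, (∫ y, G₀ y ∂(κ s x)) * (∫ y, G₀ y ∂(κ s x)) ∂μ) -
        ∫ x, (∫ y, G₀ y ∂(κ s x)) * (∫ y, (∫ z, G₀ z ∂(κ s y)) ∂(κ h x)) ∂μ := by
    rw [hcen]
    simp_rw [e1]
    rfl
  rw [hcen']
  -- the convex function `Φ`
  set Φ : ℝ → ℝ := fun u => ∫ x, G₀ x * (∫ y, G₀ y ∂(κ u.toNNReal x)) ∂μ with hΦ
  have hconv : ConvexOn ℝ (Ici (0 : ℝ)) Φ := convexOn_integral_mul_transition L β' κ hreal hG₀c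
  obtain ⟨M₀, -, hM₀⟩ := exists_abs_le_of_continuous hG₀c
  have hG₀i : ∀ (ν : Measure (GaugeConfig 3 L (Matrix.specialUnitaryGroup (Fin 2) ℂ))) [IsProbabilityMeasure ν],
      Integrable G₀ ν := fun ν _ =>
    Integrable.of_bound hG₀c.aestronglyMeasurable M₀ (Eventually.of_forall fun z => by rw [Real.norm_eq_abs]; exact hM₀ z)
  have hκ0 : κ 0 = Kernel.id := transitionKernel_zero_eq_id L β' κ hreal
  have e0 : ∫ x, (G x - m) ^ 2 ∂μ = Φ 0 := by
    simp only [hΦ, Real.toNNReal_zero, hκ0, Kernel.id_apply, integral_dirac]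
    exact integral_congr_ae (Eventually.of_forall fun x => by simp only [hG₀]; ring)
  have e2s : ∫ x, (∫ y, G₀ y ∂(κ s x)) * (∫ y, G₀ y ∂(κ s x)) ∂μ = Φ ((s : ℝ) + s) := by
    have : ((s : ℝ) + s).toNNReal = s + s := by rw [← NNReal.coe_add, Real.toNNReal_coe]
    simp only [hΦ, this]
    exact integral_transition_mul_transition_eq L β' κ hreal s s hG₀c
  have hCK : κ (h + s) = κ s ∘ₖ κ h := chapmanKolmogorov_szz β' κ hreal h s
  have eCK : ∀ x, ∫ y, (∫ z, G₀ z ∂(κ s y)) ∂(κ h x) = ∫ y, G₀ y ∂(κ (h + s) x) := by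
    intro x
    haveI : IsProbabilityMeasure ((κ s ∘ₖ κ h) x) := by rw [← hCK]; infer_instance
    rw [hCK]
    exact (Kernel.integral_comp (hG₀i _)).symm
  have e2sh : ∫ x, (∫ y, G₀ y ∂(κ s x)) * (∫ y, (∫ z, G₀ z ∂(κ s y)) ∂(κ h x)) ∂μ = Φ ((s : ℝ) + s + h) := by
    have : ((s : ℝ) + s + h).toNNReal = s + (h + s) := by
      rw [← NNReal.coe_add, ← NNReal.coe_add, Real.toNNReal_coe]; ring
    simp only [hΦ, this]
    simp_rw [eCK]
    exact integral_transition_mul_transition_eq L β' κ hreal s (h + s) hG₀c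
  have hΦ2s : 0 ≤ Φ ((s : ℝ) + s) := by
    rw [← e2s]; exact integral_nonneg fun x => mul_self_nonneg _
  rw [e0, e2s, e2sh]
  have hsR : (0 : ℝ) < s := by exact_mod_cast hs
  have h2s : (0 : ℝ) < 2 * s := by positivity
  rcases eq_or_ne h 0 with hh0 | hh0
  · simp [hh0]
  have hhpos : (0 : ℝ) < h := by
    have : (0 : ℝ≥0) < h := pos_iff_ne_zero.2 hh0
    exact_mod_cast this
  -- secant over `[0, 2s]` ≤ secant over `[2s, 2s + h]`
  have hsec := hconv.secant_mono (a := (s : ℝ) + s) (x := 0) (y := (s : ℝ) + s + h)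
    (by simp only [mem_Ici]; linarith) (by simp) (by simp only [mem_Ici]; linarith) (by linarith) (by linarith) (by linarith)
  have e3 : (Φ 0 - Φ ((s : ℝ) + s)) / (0 - ((s : ℝ) + s)) = (Φ ((s : ℝ) + s) - Φ 0) / (2 * s) := by
    rw [← neg_sub, ← neg_sub ((s : ℝ) + s) 0, sub_zero, neg_div_neg_eq, two_mul]
  have e4 : (Φ ((s : ℝ) + s + h) - Φ ((s : ℝ) + s)) / ((s : ℝ) + s + h - ((s : ℝ) + s)) =
      (Φ ((s : ℝ) + s + h) - Φ ((s : ℝ) + s)) / h := by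
    rw [show (s : ℝ) + s + h - ((s : ℝ) + s) = (h : ℝ) by ring]
  rw [e3, e4, div_le_div_iff₀ h2s hhpos] at hsec
  -- `Φ(2s) − Φ(2s+h) ≤ (h/2s)(Φ 0 − Φ(2s)) ≤ (h/2s) Φ 0`
  rw [div_mul_eq_mul_div, le_div_iff₀ h2s]
  nlinarith [hsec, hΦ2s, hhpos.le]

end Summit.QuantumFields.YangMills.Theorems.ColdStartUniversality

end
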